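/-
Copyright (c) 2026 the pub-hodgecm-mathlib formalisation cell (harness21).  Prover seat hodgecm-mathlib-A-p12 (g24), 2026-09-02.  «S3-ram» (LEAD F0P3a-plan (g13); owner p06 (g15);
(Cnt2′) chair F0P3a-p07 (g14)): the W-SIDE PACK of the (α₂) TYPE-(2) line, part 7 — the square token `LEV₂(ϖ^m)` at any scale.  `--supports stmt-HodgeConjecture-24833`.
-/
import Literature.NumberTheory.Rogawski1990.DepthZeroKappaTransferTypeTwoRamifiedWSideBalls   -- ★ (this seat) parts 1–6
import HarnessLib

/-!
# The square token `(Γ − 1)²B ⊆ ϖ^m B` on the W-side: `(Y − 1)² = (¼disc + (c − 1)²)·1 + 2(c − 1)·(Y − c·1)` (Labesse–Langlands 1979 §2; Kottwitz 1986 §3)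

Topic `NumberTheory/Rogawski1990`; namespace `Literature.NumberTheory.Automorphic.UnitaryGroup`.  THEOREMS ONLY; kernel lane `--supports stmt-HodgeConjecture-24833`; cell
`pub/hodgecm-mathlib` (D-0151), crux H413, count-neutral; seat A-p12 (g24).  HONEST LABEL: HC_CM is proved only modulo the 2 remaining named inputs (hLiu418 24832, h413 24833).

THE MATHEMATICS.  The (Cnt2′) region∕collar census (F0P3-p03 (g16) even head, F0P2-p01 (g16) collar tokens) uses the rank token `LEV₂(ϖ^m) B :⟺ (Γ − 1)²B ⊆ ϖ^m B` at scales
`m = 2d₀ − 1` beyond the `ϖ³` of ★ part 3.  For any `2 × 2` matrix `Y` with `c := ½trY` one has `(Y − 1)² = ((c² − det Y) + (c − 1)²)·1 + (2(c − 1))·(Y − c·1)` (Cayley–Hamilton for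
the traceless `Y − c·1`, ★ `sq_sub_half_trace_smul_one`); for `Y = u⁻¹Γu` the scalar is `¼(tr²Γ − 4detΓ) + (½trΓ − 1)²` and `u⁻¹(Γ − 1)²u = (Y − 1)²`, so on `B = u𝒪_w²` the token
`LEV₂(ϖ^m)` reads entrywise on `(¼disc + (c−1)²)·1 + 2(c−1)·E`, `E = Y − c·1` (whose entries ★ parts 3∕6 control): the W-side square token is decided by the two data `|disc|`
and `|c − 1|` of `Γ` together with the centred depth of `B`.

* `sub_one_mul_sub_one_eq`, `selfDual_fixed_levSq_iff`.

## References
* [LabesseLanglands1979] J.-P. Labesse, R. P. Langlands, *L-indistinguishability for SL(2)*, Canad. J. Math. 31 (1979): §2 Lemma 2.1 p. 8.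
* [Kottwitz1986] R. Kottwitz, *Base change for unit elements of Hecke algebras*, Compositio Math. 60 (1986): §3.
-/

set_option autoImplicit false

noncomputable section

open MeasureTheory Measure Set NumberField IsDedekindDomain Matrix ValuativeRel MulAction Finset Polynomial
open scoped ValuativeRel Matrix MatrixGroups WithZero

namespace Literature.NumberTheory.Automorphic.UnitaryGroup

open Literature.NumberTheory.Rogawski1990 Literature.NumberTheory.Automorphic Literature.NumberTheory.Automorphic.IntegralReduction
open Literature.NumberTheory.Automorphic.UnitaryLatticeTree Literature.NumberTheory.Automorphic.HermitianLattice Literature.GroupTheory Literature.NumberTheory.GaloisRepresentations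

section Square

/-- **`(Y − 1)² = ((c² − det Y) + (c − 1)²)·1 + (2(c − 1))·(Y − c·1)`**, `c = ½ tr Y`, for any `2 × 2` matrix over a field with `2 ≠ 0` (the traceless part squares to a scalar).
[cite: LabesseLanglands1979, §2 Lemma 2.1 p. 8] -/
theorem sub_one_mul_sub_one_eq {K : Type*} [Field K] (h2 : (2 : K) ≠ 0) (Y : Matrix (Fin 2) (Fin 2) K) :
    (Y - 1) * (Y - 1) = (((Y.trace / 2) ^ 2 - Y.det) + (Y.trace / 2 - 1) ^ 2) • (1 : Matrix (Fin 2) (Fin 2) K) + (2 * (Y.trace / 2 - 1)) • (Y - (Y.trace / 2) • (1 : Matrix (Fin 2) (Fin 2) K)) := by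
  have hCH := sq_sub_half_trace_smul_one h2 Y
  have e1 : Y - 1 = (Y - (Y.trace / 2) • (1 : Matrix (Fin 2) (Fin 2) K)) + (Y.trace / 2 - 1) • (1 : Matrix (Fin 2) (Fin 2) K) := by
    rw [sub_smul, one_smul]; abel
  rw [e1, Matrix.add_mul, Matrix.mul_add, Matrix.mul_add, hCH, Matrix.smul_mul, Matrix.mul_smul, Matrix.mul_one, Matrix.one_mul, Matrix.smul_mul, Matrix.one_mul, smul_smul,
    add_smul, ← pow_two, mul_smul, two_smul]
  abel

variable (L : Type) [Field L] [NumberField L] [IsCMField L] (v : HeightOneSpectrum (𝓞 ↥(maximalRealSubfield L))) (w : PlacesOver L v)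

set_option maxHeartbeats 800000 in
omit [IsCMField L] in
/-- **THE SQUARE TOKEN ON THE W-SIDE, ANY SCALE.**  For `Γ ∈ U(σ_w, Φ₂)`, a `Γ`-fixed self-dual `B = u·𝒪_w²` (`u ∈ U`), and any scale `m`: `(Γ − 1)²B ⊆ ϖ^m B` iff every entry of
`(¼(tr²Γ − 4detΓ) + (½trΓ − 1)²)·1 + (2(½trΓ − 1))·(u⁻¹Γu − ½trΓ·1)` has `|·|_w ≤ |ϖ^m|` (★ `map_toLin'_mapGL_stdLattice_le_scaleLattice_iff`, ★ `coe_inv_mul_sub_one_sq_mul`,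
`sub_one_mul_sub_one_eq`). [cite: Kottwitz1986, §3] [cite: LabesseLanglands1979, §2 Lemma 2.1 p. 8] -/
theorem selfDual_fixed_levSq_iff (h2 : IsUnit (2 : 𝒪[(w.1.adicCompletion L)])) (ϖ : (w.1.adicCompletion L)ˣ) (Γ u : GL (Fin 2) (w.1.adicCompletion L)) (m : ℕ) :
    (UnitaryLatticeTree.mapGL u (stdLattice (w.1.adicCompletion L) 2)).map ((Matrix.toLin' (((Γ : Matrix (Fin 2) (Fin 2) (w.1.adicCompletion L)) - 1) ^ 2)).restrictScalars (Valued.integer (w.1.adicCompletion L))) ≤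
        UnitaryLatticeTree.scaleLattice ((ϖ : (w.1.adicCompletion L)) ^ m) (UnitaryLatticeTree.mapGL u (stdLattice (w.1.adicCompletion L) 2)) ↔
      ∀ a b : Fin 2, Valued.v ((((((Γ : Matrix (Fin 2) (Fin 2) (w.1.adicCompletion L)).trace / 2) ^ 2 - (Γ : Matrix (Fin 2) (Fin 2) (w.1.adicCompletion L)).det) + ((Γ : Matrix (Fin 2) (Fin 2) (w.1.adicCompletion L)).trace / 2 - 1) ^ 2) • (1 : Matrix (Fin 2) (Fin 2) (w.1.adicCompletion L)) + (2 * ((Γ : Matrix (Fin 2) (Fin 2) (w.1.adicCompletion L)).trace / 2 - 1)) • ((((u⁻¹ * Γ * u : GL (Fin 2) (w.1.adicCompletion L))) : Matrix (Fin 2) (Fin 2) (w.1.adicCompletion L)) - ((Γ : Matrix (Fin 2) (Fin 2) (w.1.adicCompletion L)).trace / 2) • (1 : Matrix (Fin 2) (Fin 2) (w.1.adicCompletion L)))) a b) ≤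
        Valued.v ((ϖ : (w.1.adicCompletion L)) ^ m) := by
  have hϖ0 : (ϖ : (w.1.adicCompletion L)) ≠ 0 := ϖ.ne_zero
  have h2w : Valued.v (2 : (w.1.adicCompletion L)) = 1 := (isUnit_two_integer_iff_valued_eq_one L w.1).1 h2
  have h2w0 : (2 : (w.1.adicCompletion L)) ≠ 0 := fun h0 => by rw [h0, map_zero] at h2w; exact zero_ne_one h2w
  have htrc : (((u⁻¹ * Γ * u : GL (Fin 2) (w.1.adicCompletion L))) : Matrix (Fin 2) (Fin 2) (w.1.adicCompletion L)).trace = (Γ : Matrix (Fin 2) (Fin 2) (w.1.adicCompletion L)).trace := by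
    rw [Units.val_mul, Units.val_mul]; exact Matrix.trace_units_conj' u _
  have hdetc : (((u⁻¹ * Γ * u : GL (Fin 2) (w.1.adicCompletion L))) : Matrix (Fin 2) (Fin 2) (w.1.adicCompletion L)).det = (Γ : Matrix (Fin 2) (Fin 2) (w.1.adicCompletion L)).det := by
    rw [Units.val_mul, Units.val_mul]; exact Matrix.det_units_conj' u _
  have hsq := sub_one_mul_sub_one_eq h2w0 (((u⁻¹ * Γ * u : GL (Fin 2) (w.1.adicCompletion L))) : Matrix (Fin 2) (Fin 2) (w.1.adicCompletion L))
  rw [htrc, hdetc] at hsq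
  rw [map_toLin'_mapGL_stdLattice_le_scaleLattice_iff (pow_ne_zero _ hϖ0), coe_inv_mul_sub_one_sq_mul, pow_two, hsq]

end Square

end Literature.NumberTheory.Automorphic.UnitaryGroup

end
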